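import Literature.NumberTheory.EllipticCurves.CasselsTateLemma617
import Literature.NumberTheory.EllipticCurves.ArchimedeanWeilPairingDuality
import HarnessLib

/-!
# The local inputs `hdual`, `hL` of Milne I Lemma 6.15 for the descended pairing, at all places

Topic `NumberTheory/EllipticCurves`; namespace `Literature.NumberTheory.EllipticCurves` (as
`CasselsTateLemma615.lean`).  Definitions with bodies and theorems only: **no named fact is introduced**
(D-0026).

Milne, *ADT*, I Lemma 6.15 (tree `forall_mem_selmerGroup_sumPairing_eq_zero_iff`, `CasselsTateLemma615.lean`)
is stated at level `m` for the local pairings `(x, y) ↦ inv_v(x ∪_desc y)` on `H¹(K_v, E[m])`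
(`descLocalPairing`, the cup product of the descended Weil pairing `E[m] × E[m] → μ_{m²}`,
`(S, T) ↦ e_{m²}(ι S, T̃)`, followed by a local "invariant" `inv_v : H²(K_v, μ_{m²}) → ℤ/m²`) under two
local hypotheses at the places `v ∈ S`:

* `hdual` — the left kernel of `inv_v(· ∪_desc ·)` on `H¹(K_v, E[m])` is trivial (local Tate duality,
  Milne I Cor. 2.3 / Thm. 2.13(a));
* `hL` — the local Kummer condition `𝓛_v ≤ H¹(K_v, E[m])` is its own annihilator (Tate local duality for
  `E`, Milne I Cor. 3.4 / Rem. 3.7).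

This file DISCHARGES them as far as the tree allows, uniformly in the family `inv`:

* `descLocalCup_eq_zero_of_mem` — **isotropy** of `𝓛_F^{(m)}` for `∪_desc` over every `K`-field `F` of
  characteristic `0`: `x ∪_desc y = ι_* x ∪_{m²} ỹ = 0` for a local lift `ỹ ∈ 𝓛_F^{(m²)}` of `y`
  (`[m]_* ỹ = y`, tree `FirstCaseData.exists_local_lift`), `ι_* x ∈ 𝓛_F^{(m²)}`
  (`map_inclKD_mem_kummerLocalConditionAt`) and the discharged Poonen–Rains isotropy at level `m²`
  (`weilLocalCup_eq_zero_of_mem_of_fact`, `kummerClass_cupProduct_kummerClass_eq_zero_holds`);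
* `forall_mem_kummerLocalConditionAt_descLocalCup_eq_zero_iff_of_leftKernel` — **maximality** from `hdual`
  and the count `#H¹(F, E[m]) ≤ (#𝓛_F)²` (tree counting lemma
  `forall_mem_apply_eq_zero_iff_of_isotropic_of_card_le`);
* at a FINITE place: the descended dual map `E[m] → Hom(E[m], μ_{m²}(F̄))`, `T ↦ (S ↦ desc(S, T))`, is an
  isomorphism of `Γ_F`-modules (`descDualLocalIso`; injective by non-degeneracy, bijective by
  `#Hom(E[m], μ_{m²}) = #E[m]`), so the left and right kernels of `∪_desc` on `H¹(F, E[m])` are trivial by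
  the tree's PROVED local duality theorem `localDuality_bijective`
  (`eq_zero_of_forall_descCupProduct_eq_zero`, `…_right`); hence `hdual` at `v = Sum.inr v` for every family
  whose `inv_v` is injective on `H²(K_v, μ_{m²})` (`descLocalPairing_inr_eq_zero_of_forall`), and `hL` at
  `Sum.inr v` from that injectivity and Tate's local Euler-characteristic count
  `#H¹(K_v, E[m]) = (#E(K_v)[m] · #(𝓞_v/m))²` (`…_inr_of_eulerChar`, cf. `LocalTateDualityOrderForE.lean`);
* at an INFINITE place: `hdual` is `descLocalPairing_inl_eq_zero_of_forall`
  (`ArchimedeanWeilPairingDuality.lean`, Milne I Thm. 2.13(a)) and `hL` follows with the archimedean count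
  `natCard_galoisCohomology_one_torsion_le_sq_infinitePlace` (`ArchimedeanKummerImageMaximal.lean`):
  `forall_mem_kummerLocalConditionAt_descLocalPairing_eq_zero_iff_inl`, from the injectivity of `inv_w` ALONE.

Upshot for the Cassels–Tate programme (provefact `WeierstrassCurve.exists_casselsTate_pairing`): in
Lemma 6.15 the hypotheses `hdual`, `hL` at the places of `S` reduce to (i) the injectivity of the chosen
`inv_v` on `H²(K_v, μ_{m²})` for `v ∈ S` (a property of the Poitou–Tate family: `IsPerfect` at finite
places, the archimedean clause at real places) and (ii) Tate's local Euler characteristic formula for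
`E[m]` at the finite `v ∈ S` (Milne I Thm. 2.8; absent from the tree).

## References

* [MilneADT2006] J. S. Milne, *Arithmetic Duality Theorems*, 2nd ed. (2006), Ch. I: Cor. 2.3, Thm. 2.8,
  Thm. 2.13(a), Cor. 3.4, Rem. 3.7, Lemma 6.15 (and its proof, p. 86–87).
* [PoonenRains2012] B. Poonen, E. Rains, *Random maximal isotropic subspaces and Selmer groups*, JAMS 25
  (2012), Prop. 4.8, Prop. 4.10.
-/

noncomputable section

open scoped Classical

universe u

namespace Literature.NumberTheory.EllipticCurves

open CategoryTheory _root_.WeierstrassCurve Field Function NumberField IsDedekindDomain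
open Literature.NumberTheory.GaloisRepresentations Literature.NumberTheory.GaloisCohomology
open Literature.NumberTheory.GaloisRepresentations.DiscreteGaloisModule (mu MuCarrier pairing)
open scoped ContRepresentation

-- Cup products need `LocallyCompactSpace Γ`; as in the tree's cup-product files, the compactness of
-- absolute Galois groups is a local instance only.
attribute [local instance] absoluteGaloisGroup_compactSpace

attribute [local instance] finite_geomTorsion_of_neZero finite_muCarrier

/-! ## Isotropy and maximality for the descended cup product over a `K`-field -/

section AnyField

variable {K : Type u} [Field K] [NumberField K] (W : WeierstrassCurve K) (m : ℕ) [NeZero m] [W.IsElliptic]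
variable (e : geomTorsion W ((m * m : ℕ) : ℤ) → geomTorsion W ((m * m : ℕ) : ℤ) → AlgebraicClosure K)
  (hμ : ∀ S T, e S T ^ (m * m) = 1)
  (hadd₁ : ∀ S₁ S₂ T, e (S₁ + S₂) T = e S₁ T * e S₂ T)
  (hadd₂ : ∀ S T₁ T₂, e S (T₁ + T₂) = e S T₁ * e S T₂)
  (hgal : ∀ (σ : absoluteGaloisGroup K) (S T : geomTorsion W ((m * m : ℕ) : ℤ)),
    σ • e S T = e (σ • S) (σ • T))
variable (F : Type u) [Field F] [Algebra K F] [CharZero F]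

/-- **Isotropy of the local Kummer condition for the descended cup product**: for `x, y ∈ 𝓛_F^{(m)}`,
`x ∪_desc y = 0` in `H²(Γ_F, μ_{m²})` (`e` alternating).  Lift `y` to `ỹ ∈ 𝓛_F^{(m²)}` with `[m]_* ỹ = y`;
then `x ∪_desc y = ι_* x ∪_{m²} ỹ` (`weilLocalCup_map_inclKD`) with `ι_* x ∈ 𝓛_F^{(m²)}`, which vanishes by
the isotropy of `𝓛_F^{(m²)}` (Poonen–Rains 2012, Prop. 4.8; discharged in the tree).
[cite: PoonenRains2012, Prop. 4.8] [cite: MilneADT2006, Ch. I §6, proof of Prop. 6.9] -/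
theorem descLocalCup_eq_zero_of_mem (halt : ∀ T, e T T = 1)
    ⦃x y : galoisCohomology (GaloisRep.restrictField F (W.torsionGaloisModule (m : ℤ))) 1⦄
    (hx : x ∈ W.kummerLocalConditionAt (m : ℤ) F) (hy : y ∈ W.kummerLocalConditionAt (m : ℤ) F) :
    descLocalCup W m e hμ hadd₁ hadd₂ hgal F x y = 0 := by
  obtain ⟨y', hy', rfl⟩ := FirstCaseData.exists_local_lift (W := W) (m := m) F hy
  rw [← weilLocalCup_map_inclKD]
  exact weilLocalCup_eq_zero_of_mem_of_fact W m F e hμ hadd₁ hadd₂ hgal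
    (kummerClass_cupProduct_kummerClass_eq_zero_holds F) halt
    (map_inclKD_mem_kummerLocalConditionAt (W := W) (m := m) F hx) hy'

/-- **Maximal isotropy of `𝓛_F` for the descended local pairing from the left kernel and the count.**
For an additive `ι : H²(Γ_F, μ_{m²}) → ℤ/m²` such that `(x, y) ↦ ι(x ∪_desc y)` has trivial left kernel on
`H¹(F, E[m])` (`hdual`) and `#H¹(F, E[m]) ≤ (#𝓛_F)²` (`hcard`): `(∀ y ∈ 𝓛_F, ι(x ∪_desc y) = 0) ↔ x ∈ 𝓛_F`.
Isotropy is `descLocalCup_eq_zero_of_mem`, maximality the counting lemma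
`forall_mem_apply_eq_zero_iff_of_isotropic_of_card_le`.  Milne, *ADT*, I Cor. 3.4 and Lemma 6.15 (the local
input "`𝓛_v` is the exact annihilator of itself"). [cite: MilneADT2006, Ch. I, Cor. 3.4 and Lemma 6.15] -/
theorem forall_mem_kummerLocalConditionAt_descLocalCup_eq_zero_iff_of_leftKernel (halt : ∀ T, e T T = 1)
    [Finite (galoisCohomology (GaloisRep.restrictField F (W.torsionGaloisModule (m : ℤ))) 1)]
    (ι : galoisCohomology (GaloisRep.restrictField F (mu K (m * m))) 2 →+ ZMod (m * m))
    (hdual : ∀ x : galoisCohomology (GaloisRep.restrictField F (W.torsionGaloisModule (m : ℤ))) 1,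
      (∀ y, ι (descLocalCup W m e hμ hadd₁ hadd₂ hgal F x y) = 0) → x = 0)
    (hcard : Nat.card (galoisCohomology (GaloisRep.restrictField F (W.torsionGaloisModule (m : ℤ))) 1) ≤
      Nat.card (W.kummerLocalConditionAt (m : ℤ) F) * Nat.card (W.kummerLocalConditionAt (m : ℤ) F))
    (x : galoisCohomology (GaloisRep.restrictField F (W.torsionGaloisModule (m : ℤ))) 1) :
    (∀ y ∈ W.kummerLocalConditionAt (m : ℤ) F, ι (descLocalCup W m e hμ hadd₁ hadd₂ hgal F x y) = 0) ↔
      x ∈ W.kummerLocalConditionAt (m : ℤ) F := by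
  haveI : NeZero (m * m) := ⟨mul_ne_zero (NeZero.ne m) (NeZero.ne m)⟩
  let b : galoisCohomology (GaloisRep.restrictField F (W.torsionGaloisModule (m : ℤ))) 1 →+
      galoisCohomology (GaloisRep.restrictField F (W.torsionGaloisModule (m : ℤ))) 1 →+ ZMod (m * m) :=
    (descLocalCup W m e hμ hadd₁ hadd₂ hgal F).compr₂ ι
  have hb : ∀ x y, b x y = ι (descLocalCup W m e hμ hadd₁ hadd₂ hgal F x y) := fun _ _ => rfl
  have hbinj : Injective b := (injective_iff_map_eq_zero _).mpr fun x hx => hdual x fun y => by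
    rw [← hb, hx, AddMonoidHom.zero_apply]
  have hH : ∀ y : galoisCohomology (GaloisRep.restrictField F (W.torsionGaloisModule (m : ℤ))) 1,
      (m * m) • y = 0 :=
    galoisCohomology.nsmul_eq_zero_of_forall _ fun T : geomTorsion W (m : ℤ) => by
      rw [mul_nsmul', AddSubgroup.torsionBy.nsmul T, smul_zero]
  exact forall_mem_apply_eq_zero_iff_of_isotropic_of_card_le b hH hbinj (W.kummerLocalConditionAt (m : ℤ) F)
    (W.kummerLocalConditionAt (m : ℤ) F)
    (fun x hx y hy => (hb x y).trans ((congrArg ι (descLocalCup_eq_zero_of_mem W m e hμ hadd₁ hadd₂ hgal F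
      halt hx hy)).trans (map_zero ι))) hcard x

end AnyField

/-! ## The descended dual map and the kernels of `∪_desc` over a non-archimedean local field -/

section LocalField

variable {K : Type u} [Field K] [CharZero K] (W : WeierstrassCurve K) (m : ℕ) [NeZero m] [W.IsElliptic]
variable (e : geomTorsion W ((m * m : ℕ) : ℤ) → geomTorsion W ((m * m : ℕ) : ℤ) → AlgebraicClosure K)
  (hμ : ∀ S T, e S T ^ (m * m) = 1)
  (hadd₁ : ∀ S₁ S₂ T, e (S₁ + S₂) T = e S₁ T * e S₂ T)
  (hadd₂ : ∀ S T₁ T₂, e S (T₁ + T₂) = e S T₁ * e S T₂)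
variable (F : Type u) [Field F] [Algebra K F] [CharZero F]

/-- `m² ≠ 0` (local instance helper). [folklore] -/
theorem neZero_mul_self : NeZero (m * m) := ⟨mul_ne_zero (NeZero.ne m) (NeZero.ne m)⟩

attribute [local instance] neZero_mul_self

/-- **The descended dual map over `F`**: `E[m] → Hom(E[m], μ_{m²}(F̄))`, `T ↦ (S ↦ ι desc(S, T))`, `ι` the
transfer `μ_{m²}(K̄) → μ_{m²}(F̄)` along the chosen embedding (`muTransfer`); built like the tree's
`weilDualLocalHom`. [cite: MilneADT2006, Ch. I §6, proof of Prop. 6.9] -/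
def descDualLocalHom : geomTorsion W (m : ℤ) →+ HomCarrier (geomTorsion W (m : ℤ)) (MuCarrier F (m * m)) :=
  AddMonoidHom.mk'
    (fun T => HomCarrier.ofAddMonoidHom
      ((muTransfer K F (m * m)).comp ((descendHom W m m e hμ hadd₁ hadd₂).flip T)))
    fun T T' => HomCarrier.ext fun S => by
      rw [HomCarrier.add_apply, HomCarrier.ofAddMonoidHom_apply, HomCarrier.ofAddMonoidHom_apply,
        HomCarrier.ofAddMonoidHom_apply, AddMonoidHom.comp_apply, AddMonoidHom.comp_apply,
        AddMonoidHom.comp_apply, map_add, AddMonoidHom.add_apply, map_add]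

omit [W.IsElliptic] [CharZero F] in
/-- Unfolding `descDualLocalHom`: `(d T)(S) = ι desc(S, T)`. [folklore] -/
@[simp]
theorem descDualLocalHom_apply_apply (S T : geomTorsion W (m : ℤ)) :
    descDualLocalHom W m e hμ hadd₁ hadd₂ F T S = muTransfer K F (m * m) (descendHom W m m e hμ hadd₁ hadd₂ S T) :=
  rfl

omit [CharZero F] in
/-- **The descended dual map is `Γ_F`-equivariant** (`desc` is equivariant, `descendHom_smul`, and so is the
transfer of roots of unity, `muTransfer_mu`). [folklore] -/
theorem descDualLocalHom_smul
    (hgal : ∀ (σ : absoluteGaloisGroup K) (S T : geomTorsion W ((m * m : ℕ) : ℤ)), σ • e S T = e (σ • S) (σ • T))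
    (σ : absoluteGaloisGroup F) (T : geomTorsion W (m : ℤ)) :
    descDualLocalHom W m e hμ hadd₁ hadd₂ F ((GaloisRep.restrictField F (W.torsionGaloisModule (m : ℤ))) σ T) =
      (ContinuousRep.homRep (GaloisRep.restrictField F (W.torsionGaloisModule (m : ℤ))) (mu F (m * m))) σ
        (descDualLocalHom W m e hμ hadd₁ hadd₂ F T) := by
  refine HomCarrier.ext fun S => ?_
  have hσ : ∀ (τ : absoluteGaloisGroup F) (P : geomTorsion W (m : ℤ)),
      (GaloisRep.restrictField F (W.torsionGaloisModule (m : ℤ))) τ P = absGaloisRestrict K F τ • P :=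
    fun _ _ => rfl
  rw [ContinuousRep.homRep_apply_apply_apply, descDualLocalHom_apply_apply, descDualLocalHom_apply_apply, hσ,
    hσ, map_inv (absGaloisRestrict K F) σ, ← muTransfer_mu]
  congr 1
  -- `desc(S, σT) = σ desc(σ⁻¹ S, T)`
  have h := descendHom_smul W m m e hμ hadd₁ hadd₂ hgal (absGaloisRestrict K F σ)
    ((absGaloisRestrict K F σ)⁻¹ • S) T
  rw [smul_inv_smul] at h
  exact h

omit [W.IsElliptic] [CharZero F] in
/-- The descended dual map is injective (`desc` is non-degenerate in the second variable,
`descendHom_flip_injective`, and `μ(K̄) → μ(F̄)` is injective). [folklore] -/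
theorem descDualLocalHom_injective (hnd : ∀ T, (∀ S, e S T = 1) → T = 0) :
    Injective (descDualLocalHom W m e hμ hadd₁ hadd₂ F) := by
  refine (injective_iff_map_eq_zero _).mpr fun T hT =>
    eq_zero_of_forall_descendHom_eq_zero W m m e hμ hadd₁ hadd₂ hnd T fun S => ?_
  have h' := congrArg (fun f : HomCarrier (geomTorsion W (m : ℤ)) (MuCarrier F (m * m)) => f S) hT
  simp only [descDualLocalHom_apply_apply, HomCarrier.zero_apply] at h'
  exact muTransfer_injective K F (m * m) (h'.trans (map_zero _).symm)

/-- **The descended dual map is bijective** (injective, and `#Hom(E[m], μ_{m²}(F̄)) = #E[m]`, `E[m]` being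
killed by `m²`; `HomCarrier.natCard_eq` with `μ_{m²}(F̄) ≃ ℤ/m²`). [folklore] -/
theorem descDualLocalHom_bijective (hnd : ∀ T, (∀ S, e S T = 1) → T = 0) :
    Bijective (descDualLocalHom W m e hμ hadd₁ hadd₂ F) :=
  (descDualLocalHom_injective W m e hμ hadd₁ hadd₂ F hnd).bijective_of_nat_card_le
    (HomCarrier.natCard_eq (muEquivZMod F (m * m)) (fun T : geomTorsion W (m : ℤ) => by
      rw [mul_nsmul', AddSubgroup.torsionBy.nsmul T, smul_zero])).le

/-- **`E[m](K̄)|_{Γ_F} ≅ Hom(E[m], μ_{m²}(F̄))` as discrete `Γ_F`-modules** through the descended pairing.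
[cite: MilneADT2006, Ch. I §6, proof of Prop. 6.9] -/
def descDualLocalIso
    (hgal : ∀ (σ : absoluteGaloisGroup K) (S T : geomTorsion W ((m * m : ℕ) : ℤ)), σ • e S T = e (σ • S) (σ • T))
    (hnd : ∀ T, (∀ S, e S T = 1) → T = 0) :
    TopRep.res (absGaloisRestrict K F : absoluteGaloisGroup F →* absoluteGaloisGroup K)
        (W.torsionGaloisModule (m : ℤ)).toTopRep ≅
      (ContinuousRep.homRep (GaloisRep.restrictField F (W.torsionGaloisModule (m : ℤ))) (mu F (m * m))).toTopRep :=
  topRepIsoOfEquiv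
    (X := TopRep.res (absGaloisRestrict K F : absoluteGaloisGroup F →* absoluteGaloisGroup K)
      (W.torsionGaloisModule (m : ℤ)).toTopRep)
    (Y := (ContinuousRep.homRep (GaloisRep.restrictField F (W.torsionGaloisModule (m : ℤ))) (mu F (m * m))).toTopRep)
    { (AddEquiv.ofBijective _
        (descDualLocalHom_bijective W m e hμ hadd₁ hadd₂ F hnd)).toIntLinearEquiv with
      continuous_toFun := continuous_of_discreteTopology
      continuous_invFun := continuous_of_discreteTopology }
    fun σ T => descDualLocalHom_smul W m e hμ hadd₁ hadd₂ F hgal σ T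

/-- **`H²(μ-iso)(x ∪_desc y) = x ∪_{ev} H¹(d)(y)`**: the descended cup product carried to `H²(Γ_F, μ_{m²}(F̄))` is
the evaluation cup product of the tree's local duality theorem after the descended dual isomorphism
(`ContPairing.cupProduct_map`). [folklore] -/
theorem cohomologyMap_muRestrictIso_descCupProduct
    (hgal : ∀ (σ : absoluteGaloisGroup K) (S T : geomTorsion W ((m * m : ℕ) : ℤ)), σ • e S T = e (σ • S) (σ • T))
    (hnd : ∀ T, (∀ S, e S T = 1) → T = 0)
    (x y : galoisCohomology (GaloisRep.restrictField F (W.torsionGaloisModule (m : ℤ))) 1) :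
    cohomologyMap (muRestrictIso K (m * m) F).hom 2
        (((descendPairing W m m e hμ hadd₁ hadd₂ hgal).restrict (absGaloisRestrict K F)).cupProduct x y) =
      ((GaloisRep.restrictField F (W.torsionGaloisModule (m : ℤ))).evalPairing (mu F (m * m))).cupProduct x
        (cohomologyMap (descDualLocalIso W m e hμ hadd₁ hadd₂ F hgal hnd).hom 1 y) := by
  refine (ContPairing.cupProduct_map
    ((descendPairing W m m e hμ hadd₁ hadd₂ hgal).restrict (absGaloisRestrict K F))
    ((GaloisRep.restrictField F (W.torsionGaloisModule (m : ℤ))).evalPairing (mu F (m * m))) (𝟙 _)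
    (descDualLocalIso W m e hμ hadd₁ hadd₂ F hgal hnd).hom (muRestrictIso K (m * m) F).hom
    (fun _ _ => rfl) x y).trans ?_
  exact congrArg (fun z => ((GaloisRep.restrictField F (W.torsionGaloisModule (m : ℤ))).evalPairing
      (mu F (m * m))).cupProduct z (cohomologyMap (descDualLocalIso W m e hμ hadd₁ hadd₂ F hgal hnd).hom 1 y))
    (map_apply_of_id _ (fun _ => rfl) _ (fun _ => rfl) 1 x)

variable [ValuativeRel F] [TopologicalSpace F] [IsNonarchimedeanLocalField F]

/-- **Left kernel of `∪_desc` over a non-archimedean local `K`-field `F`** (local Tate duality, Milne I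
Cor. 2.3, for `M = E[m]` and `M^D = Hom(E[m], μ_{m²}) ≅ E[m]` through the descended pairing): if
`x ∪_desc y = 0` for all `y ∈ H¹(F, E[m])` then `x = 0` (tree `localDuality_bijective` along `descDualLocalIso`).
[cite: MilneADT2006, Ch. I, Cor. 2.3] -/
theorem eq_zero_of_forall_descCupProduct_eq_zero
    (hgal : ∀ (σ : absoluteGaloisGroup K) (S T : geomTorsion W ((m * m : ℕ) : ℤ)), σ • e S T = e (σ • S) (σ • T))
    (hnd : ∀ T, (∀ S, e S T = 1) → T = 0)
    (x : galoisCohomology (GaloisRep.restrictField F (W.torsionGaloisModule (m : ℤ))) 1)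
    (hx : ∀ y, ((descendPairing W m m e hμ hadd₁ hadd₂ hgal).restrict (absGaloisRestrict K F)).cupProduct x y = 0) :
    x = 0 := by
  obtain ⟨ι, -, hb, -⟩ := localDuality_bijective F
    (GaloisRep.restrictField F (W.torsionGaloisModule (m : ℤ)) :
      ContinuousRep (absoluteGaloisGroup F) ℤ (geomTorsion W (m : ℤ)))
    (fun T : geomTorsion W (m : ℤ) => show (m * m) • T = 0 by
      rw [mul_nsmul', AddSubgroup.torsionBy.nsmul T, smul_zero])
  have h0 : (GaloisRep.restrictField F (W.torsionGaloisModule (m : ℤ))).dualityPairing (mu F (m * m)) ι x = 0 := by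
    refine AddMonoidHom.ext fun y' => ?_
    obtain ⟨y, hy'⟩ :=
      (continuousCohomologyEquivOfIso (descDualLocalIso W m e hμ hadd₁ hadd₂ F hgal hnd) 1).surjective y'
    rw [ContinuousRep.dualityPairing_apply, AddMonoidHom.zero_apply, ← hy']
    change ι (((GaloisRep.restrictField F (W.torsionGaloisModule (m : ℤ))).evalPairing (mu F (m * m))).cupProduct x
      (cohomologyMap (descDualLocalIso W m e hμ hadd₁ hadd₂ F hgal hnd).hom 1 y)) = 0
    rw [← cohomologyMap_muRestrictIso_descCupProduct W m e hμ hadd₁ hadd₂ F hgal hnd, hx y, map_zero, map_zero]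
  exact hb.1 (h0.trans (map_zero _).symm)

/-- **Right kernel of `∪_desc` over a non-archimedean local `K`-field `F`.** [cite: MilneADT2006, Ch. I, Cor. 2.3] -/
theorem eq_zero_of_forall_descCupProduct_eq_zero_right
    (hgal : ∀ (σ : absoluteGaloisGroup K) (S T : geomTorsion W ((m * m : ℕ) : ℤ)), σ • e S T = e (σ • S) (σ • T))
    (hnd : ∀ T, (∀ S, e S T = 1) → T = 0)
    (y : galoisCohomology (GaloisRep.restrictField F (W.torsionGaloisModule (m : ℤ))) 1)
    (hy : ∀ x, ((descendPairing W m m e hμ hadd₁ hadd₂ hgal).restrict (absGaloisRestrict K F)).cupProduct x y = 0) :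
    y = 0 := by
  obtain ⟨ι, -, -, hbf⟩ := localDuality_bijective F
    (GaloisRep.restrictField F (W.torsionGaloisModule (m : ℤ)) :
      ContinuousRep (absoluteGaloisGroup F) ℤ (geomTorsion W (m : ℤ)))
    (fun T : geomTorsion W (m : ℤ) => show (m * m) • T = 0 by
      rw [mul_nsmul', AddSubgroup.torsionBy.nsmul T, smul_zero])
  have h0 : ((GaloisRep.restrictField F (W.torsionGaloisModule (m : ℤ))).dualityPairing (mu F (m * m)) ι).flip
      (cohomologyMap (descDualLocalIso W m e hμ hadd₁ hadd₂ F hgal hnd).hom 1 y) = 0 := by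
    refine AddMonoidHom.ext fun x => ?_
    rw [AddMonoidHom.flip_apply, ContinuousRep.dualityPairing_apply, AddMonoidHom.zero_apply,
      ← cohomologyMap_muRestrictIso_descCupProduct, hy x, map_zero, map_zero]
  have h1 : cohomologyMap (descDualLocalIso W m e hμ hadd₁ hadd₂ F hgal hnd).hom 1 y = 0 :=
    hbf.1 (h0.trans (map_zero _).symm)
  have h2 : cohomologyMap (descDualLocalIso W m e hμ hadd₁ hadd₂ F hgal hnd).hom 1 y =
      cohomologyMap (descDualLocalIso W m e hμ hadd₁ hadd₂ F hgal hnd).hom 1 0 := by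
    rw [h1, map_zero]
  exact (continuousCohomologyEquivOfIso (descDualLocalIso W m e hμ hadd₁ hadd₂ F hgal hnd) 1).injective h2

end LocalField

/-! ## The hypotheses `hdual`, `hL` of Lemma 6.15 at the places of `K` -/

section Places

variable {K : Type u} [Field K] [NumberField K] (W : WeierstrassCurve K) (m : ℕ) [NeZero m] [W.IsElliptic]
variable (e : geomTorsion W ((m * m : ℕ) : ℤ) → geomTorsion W ((m * m : ℕ) : ℤ) → AlgebraicClosure K)
  (hμ : ∀ S T, e S T ^ (m * m) = 1)
  (hadd₁ : ∀ S₁ S₂ T, e (S₁ + S₂) T = e S₁ T * e S₂ T)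
  (hadd₂ : ∀ S T₁ T₂, e S (T₁ + T₂) = e S T₁ * e S T₂)
  (hgal : ∀ (σ : absoluteGaloisGroup K) (S T : geomTorsion W ((m * m : ℕ) : ℤ)),
    σ • e S T = e (σ • S) (σ • T))
  (halt : ∀ T, e T T = 1) (hnd : ∀ T, (∀ S, e S T = 1) → T = 0) (inv : LocalInvariants K (m * m))

include hnd in
/-- **`hdual` of Lemma 6.15 at a finite place `Sum.inr v`**: if `inv_v` is injective on `H²(K_v, μ_{m²})`
(e.g. bijective, the first clause of `LocalInvariants.IsPerfect`), the local pairing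
`descLocalPairing … inv (Sum.inr v) = inv_v(· ∪_desc ·)` on `H¹(K_v, E[m])` has trivial left kernel (the bare
cup product already has, `eq_zero_of_forall_descCupProduct_eq_zero`). [cite: MilneADT2006, Ch. I, Cor. 2.3 and Lemma 6.15] -/
theorem descLocalPairing_inr_eq_zero_of_forall (v : HeightOneSpectrum (𝓞 K)) (hinv : Injective (inv (Sum.inr v)))
    (x : galoisCohomology (GaloisRep.restrictField (Place.Completion (Sum.inr v : Place K))
      (W.torsionGaloisModule (m : ℤ))) 1)
    (hx : ∀ y, descLocalPairing W m e hμ hadd₁ hadd₂ hgal inv (Sum.inr v) x y = 0) : x = 0 := by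
  haveI : CharZero (v.adicCompletion K) := charZero_adicCompletion v
  have h := eq_zero_of_forall_descCupProduct_eq_zero W m e hμ hadd₁ hadd₂ (v.adicCompletion K) hgal hnd
  exact h x fun y => hinv ((hx y).trans (map_zero _).symm)

include halt hnd in
/-- **`hL` of Lemma 6.15 at a finite place `Sum.inr v` from the Euler-characteristic count**: if `inv_v` is
injective on `H²(K_v, μ_{m²})` and `#H¹(K_v, E[m]) = (#E(K_v)[m] · #(𝓞_v/m))²` (Tate's local Euler
characteristic formula for `E[m]`, Milne I Thm. 2.8 with 2.3; `#𝓛_v = #E(K_v)[m] · #(𝓞_v/m)` is the tree's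
`natCard_kummerLocalConditionAt_adicCompletion`), then `𝓛_v` is its own annihilator under
`inv_v(· ∪_desc ·)`. [cite: MilneADT2006, Ch. I, Thm. 2.8, Cor. 3.4 and Lemma 6.15] -/
theorem forall_mem_kummerLocalConditionAt_descLocalPairing_eq_zero_iff_inr_of_eulerChar
    (v : HeightOneSpectrum (𝓞 K)) (hinv : Injective (inv (Sum.inr v)))
    (hEuler : Nat.card (galoisCohomology
        (GaloisRep.restrictField (v.adicCompletion K) (W.torsionGaloisModule (m : ℤ))) 1) =
      (Nat.card (nsmulAddMonoidHom m :
            (W.baseChange (v.adicCompletion K)).toAffine.Point →+ _).ker *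
          Nat.card (v.adicCompletionIntegers K ⧸
            Ideal.span {(m : v.adicCompletionIntegers K)})) ^ 2)
    (x : galoisCohomology (GaloisRep.restrictField (Place.Completion (Sum.inr v : Place K))
      (W.torsionGaloisModule (m : ℤ))) 1) :
    (∀ y ∈ W.kummerLocalConditionAt (m : ℤ) (Place.Completion (Sum.inr v : Place K)),
        descLocalPairing W m e hμ hadd₁ hadd₂ hgal inv (Sum.inr v) x y = 0) ↔
      x ∈ W.kummerLocalConditionAt (m : ℤ) (Place.Completion (Sum.inr v : Place K)) := by
  haveI : CharZero (v.adicCompletion K) := charZero_adicCompletion v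
  haveI := finite_galoisCohomology_one_adicCompletion v
    (GaloisRep.restrictField (v.adicCompletion K) (W.torsionGaloisModule (m : ℤ)))
  have hcard : Nat.card (galoisCohomology
      (GaloisRep.restrictField (v.adicCompletion K) (W.torsionGaloisModule (m : ℤ))) 1) ≤
        Nat.card (W.kummerLocalConditionAt (m : ℤ) (v.adicCompletion K)) *
          Nat.card (W.kummerLocalConditionAt (m : ℤ) (v.adicCompletion K)) := by
    rw [hEuler, sq, W.natCard_kummerLocalConditionAt_adicCompletion v (NeZero.ne m)]
  -- all `Place.Completion (Sum.inr v)`-typed arguments are supplied at `exact` (definitional unfolding of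
  -- `Place.Completion`, as in the tree's `…_inr` lemmas)
  have h := forall_mem_kummerLocalConditionAt_descLocalCup_eq_zero_iff_of_leftKernel W m e hμ hadd₁ hadd₂ hgal
    (v.adicCompletion K) halt
  exact h (inv (Sum.inr v))
    (fun x hx => descLocalPairing_inr_eq_zero_of_forall W m e hμ hadd₁ hadd₂ hgal hnd inv v hinv x hx) hcard x

include halt hnd in
/-- **`hL` of Lemma 6.15 at an infinite place `Sum.inl w`, from the injectivity of `inv_w` alone**:
`𝓛_w` is its own annihilator under `inv_w(· ∪_desc ·)` on `H¹(K_w, E[m])` — left kernel by archimedean local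
duality (`descLocalPairing_inl_eq_zero_of_forall`, Milne I Thm. 2.13(a)), count by
`natCard_galoisCohomology_one_torsion_le_sq_infinitePlace` (Milne I Rem. 3.7, proved in the tree without Lie
theory). [cite: MilneADT2006, Ch. I, Thm. 2.13, Rem. 3.7 and Lemma 6.15] -/
theorem forall_mem_kummerLocalConditionAt_descLocalPairing_eq_zero_iff_inl (w : InfinitePlace K)
    (hinv : Injective (inv (Sum.inl w)))
    (x : galoisCohomology (GaloisRep.restrictField (Place.Completion (Sum.inl w : Place K))
      (W.torsionGaloisModule (m : ℤ))) 1) :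
    (∀ y ∈ W.kummerLocalConditionAt (m : ℤ) (Place.Completion (Sum.inl w : Place K)),
        descLocalPairing W m e hμ hadd₁ hadd₂ hgal inv (Sum.inl w) x y = 0) ↔
      x ∈ W.kummerLocalConditionAt (m : ℤ) (Place.Completion (Sum.inl w : Place K)) := by
  haveI := finite_absoluteGaloisGroup_completion_infinitePlace w
  haveI : CharZero w.Completion := charZero_of_injective_algebraMap (algebraMap K w.Completion).injective
  have hm : (m : ℤ) ≠ 0 := Int.natCast_ne_zero.mpr (NeZero.ne m)
  haveI := W.finite_galoisCohomology_one_torsion_restrictField_of_finite w.Completion hm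
  have h := forall_mem_kummerLocalConditionAt_descLocalCup_eq_zero_iff_of_leftKernel W m e hμ hadd₁ hadd₂ hgal
    w.Completion halt
  exact h (inv (Sum.inl w))
    (fun x hx => descLocalPairing_inl_eq_zero_of_forall W m e hμ hadd₁ hadd₂ hgal halt hnd inv w hinv x hx)
    (W.natCard_galoisCohomology_one_torsion_le_sq_infinitePlace w hm) x

include halt hnd in
/-- **`hdual` of Lemma 6.15 at every place of a finite set `S`, from the injectivity of the `inv_v`,
`v ∈ S`** (finite places: `descLocalPairing_inr_eq_zero_of_forall`; infinite places:
`descLocalPairing_inl_eq_zero_of_forall`) — exactly the binder `hdual` of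
`forall_mem_selmerGroup_sumPairing_eq_zero_iff`. [cite: MilneADT2006, Ch. I, Cor. 2.3, Thm. 2.13 and Lemma 6.15] -/
theorem hdual_of_injective (S : Finset (Place K)) (hinv : ∀ v ∈ S, Injective (inv v)) :
    ∀ v ∈ S, ∀ x : galoisCohomology (GaloisRep.restrictField (Place.Completion v) (W.torsionGaloisModule (m : ℤ))) 1,
      (∀ y, descLocalPairing W m e hμ hadd₁ hadd₂ hgal inv v x y = 0) → x = 0 := by
  rintro (w | v) hv x hx
  · exact descLocalPairing_inl_eq_zero_of_forall W m e hμ hadd₁ hadd₂ hgal halt hnd inv w (hinv _ hv) x hx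
  · exact descLocalPairing_inr_eq_zero_of_forall W m e hμ hadd₁ hadd₂ hgal hnd inv v (hinv _ hv) x hx

include halt hnd in
/-- **`hL` of Lemma 6.15 at every place of a finite set `S`**, from the injectivity of the `inv_v` (`v ∈ S`) and
Tate's local Euler-characteristic count at the finite places of `S` — exactly the binder `hL` of
`forall_mem_selmerGroup_sumPairing_eq_zero_iff`. [cite: MilneADT2006, Ch. I, Thm. 2.8, Cor. 3.4, Rem. 3.7 and Lemma 6.15] -/
theorem hL_of_injective_of_eulerChar (S : Finset (Place K)) (hinv : ∀ v ∈ S, Injective (inv v))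
    (hEuler : ∀ v : HeightOneSpectrum (𝓞 K), (Sum.inr v : Place K) ∈ S →
      Nat.card (galoisCohomology (GaloisRep.restrictField (v.adicCompletion K) (W.torsionGaloisModule (m : ℤ))) 1) =
        (Nat.card (nsmulAddMonoidHom m : (W.baseChange (v.adicCompletion K)).toAffine.Point →+ _).ker *
          Nat.card (v.adicCompletionIntegers K ⧸ Ideal.span {(m : v.adicCompletionIntegers K)})) ^ 2) :
    ∀ v ∈ S, ∀ x : galoisCohomology (GaloisRep.restrictField (Place.Completion v) (W.torsionGaloisModule (m : ℤ))) 1,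
      (∀ y ∈ W.kummerLocalConditionAt (m : ℤ) (Place.Completion v),
          descLocalPairing W m e hμ hadd₁ hadd₂ hgal inv v x y = 0) ↔
        x ∈ W.kummerLocalConditionAt (m : ℤ) (Place.Completion v) := by
  rintro (w | v) hv x
  · exact forall_mem_kummerLocalConditionAt_descLocalPairing_eq_zero_iff_inl W m e hμ hadd₁ hadd₂ hgal halt hnd inv
      w (hinv _ hv) x
  · exact forall_mem_kummerLocalConditionAt_descLocalPairing_eq_zero_iff_inr_of_eulerChar W m e hμ hadd₁ hadd₂
      hgal halt hnd inv v (hinv _ hv) (hEuler v hv) x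

include halt hnd in
/-- **Milne I Lemma 6.15 with its local hypotheses discharged**: the tree's
`forall_mem_selmerGroup_sumPairing_eq_zero_iff` (Lemma 6.15 at level `m` for the family `inv`) with `hdual` and
`hL` replaced by (i) the injectivity of `inv_v` on `H²(K_v, μ_{m²})` for `v ∈ S` and (ii) Tate's local
Euler-characteristic count for `E[m]` at the finite places of `S` (Milne I Thm. 2.8); the global hypothesis
`hG` (Poitou–Tate, Milne I Thm. 4.10, exactness at `⊕_{v∈S} H¹(K_v, E[m])`) is unchanged.
[cite: MilneADT2006, Ch. I, Lemma 6.15] -/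
theorem forall_mem_selmerGroup_sumPairing_eq_zero_iff_of_injective_of_eulerChar (S : Finset (Place K))
    (hinv : ∀ v ∈ S, Injective (inv v))
    (hEuler : ∀ v : HeightOneSpectrum (𝓞 K), (Sum.inr v : Place K) ∈ S →
      Nat.card (galoisCohomology (GaloisRep.restrictField (v.adicCompletion K) (W.torsionGaloisModule (m : ℤ))) 1) =
        (Nat.card (nsmulAddMonoidHom m : (W.baseChange (v.adicCompletion K)).toAffine.Point →+ _).ker *
          Nat.card (v.adicCompletionIntegers K ⧸ Ideal.span {(m : v.adicCompletionIntegers K)})) ^ 2)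
    (hG : ∀ x : LocalClasses W m S,
      (∀ c ∈ kummerOutside W m S, sumPairing W m e hμ hadd₁ hadd₂ hgal inv S x (locS W m S c) = 0) ↔
        ∃ c ∈ kummerOutside W m S, locS W m S c = x)
    (x : LocalClasses W m S) :
    (∀ b' ∈ selmerGroup W (m : ℤ), sumPairing W m e hμ hadd₁ hadd₂ hgal inv S x (locS W m S b') = 0) ↔
      ∃ b₀ ∈ kummerOutside W m S, ∀ v : S,
        x v - locS W m S b₀ v ∈ W.kummerLocalConditionAt (m : ℤ) (Place.Completion (v : Place K)) :=
  forall_mem_selmerGroup_sumPairing_eq_zero_iff e hμ hadd₁ hadd₂ hgal inv S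
    (hdual_of_injective W m e hμ hadd₁ hadd₂ hgal halt hnd inv S hinv)
    (hL_of_injective_of_eulerChar W m e hμ hadd₁ hadd₂ hgal halt hnd inv S hinv hEuler) hG x

include halt hnd in
/-- **Milne I Lemma 6.17 (hard direction) with the local inputs of Lemma 6.15 discharged**: the tree's
`exists_mem_sha_smul_eq_of_forall_ctFirstCaseFun_eq_zero` (`CasselsTateLemma617.lean`) with its hypothesis
`h615` supplied by `forall_mem_selmerGroup_sumPairing_eq_zero_iff_of_injective_of_eulerChar`, and the isotropy
`hiso` by the discharged Poonen–Rains fact.  Remaining hypotheses, all on the family `inv` or non-`E`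
arithmetic: the reciprocity predicate `hPT`, the injectivity of every `inv_v` on `H²(K_v, μ_{m²})`, Tate's local
Euler-characteristic count for `E[m]` at the finite places (Milne I Thm. 2.8), and the Poitou–Tate exactness `hG`
at `⊕_{v∈S} H¹(K_v, E[m])` for the finite sets `S ⊇ S₀` (Milne I Thm. 4.10).  Conclusion: an `a ∈ Ш(E/K)[m]`
divisible by `m` in `H¹(K, E)` and orthogonal to `Ш(E/K)[m]` under the first-case pairing lies in `m Ш(E/K)`.
[cite: MilneADT2006, Ch. I §6, Lemma 6.17 and Thm. 6.13(a)] -/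
theorem exists_mem_sha_smul_eq_of_forall_ctFirstCaseFun_eq_zero_of_injective_of_eulerChar
    (hPT : inv.SumLocalTermEqZero) (S₀ : Finset (Place K)) (hinvK : ∀ v : Place K, Injective (inv v))
    (hEuler : ∀ v : HeightOneSpectrum (𝓞 K),
      Nat.card (galoisCohomology (GaloisRep.restrictField (v.adicCompletion K) (W.torsionGaloisModule (m : ℤ))) 1) =
        (Nat.card (nsmulAddMonoidHom m : (W.baseChange (v.adicCompletion K)).toAffine.Point →+ _).ker *
          Nat.card (v.adicCompletionIntegers K ⧸ Ideal.span {(m : v.adicCompletionIntegers K)})) ^ 2)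
    (hG : ∀ S : Finset (Place K), S₀ ⊆ S → ∀ x : LocalClasses W m S,
      (∀ c ∈ kummerOutside W m S, sumPairing W m e hμ hadd₁ hadd₂ hgal inv S x (locS W m S c) = 0) ↔
        ∃ c ∈ kummerOutside W m S, locS W m S c = x)
    {a a₁ : W.galH1} (ha : a ∈ W.sha) (hma : (m : ℤ) • a = 0) (ha₁ : (m : ℤ) • a₁ = a)
    (horth : ∀ a' ∈ W.sha, (m : ℤ) • a' = 0 → ctFirstCaseFun W m e hμ hadd₁ hadd₂ hgal inv a a' = 0) :
    ∃ a₀ ∈ W.sha, (m : ℤ) • a₀ = a := by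
  have hiso : ∀ (v : Place K) ⦃x y : galoisCohomology (GaloisRep.restrictField (Place.Completion v)
      (W.torsionGaloisModule ((m * m : ℕ) : ℤ))) 1⦄,
      x ∈ W.kummerLocalConditionAt ((m * m : ℕ) : ℤ) (Place.Completion v) →
        y ∈ W.kummerLocalConditionAt ((m * m : ℕ) : ℤ) (Place.Completion v) →
          weilLocalCup W m (Place.Completion v) e hμ hadd₁ hadd₂ hgal x y = 0 := fun v x y hx hy => by
    haveI := charZero_placeCompletion (K := K) v
    exact weilLocalCup_eq_zero_of_mem_of_fact W m (Place.Completion v) e hμ hadd₁ hadd₂ hgal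
      (kummerClass_cupProduct_kummerClass_eq_zero_holds _) halt hx hy
  exact exists_mem_sha_smul_eq_of_forall_ctFirstCaseFun_eq_zero inv hiso hPT S₀
    (fun S hS x hx => (forall_mem_selmerGroup_sumPairing_eq_zero_iff_of_injective_of_eulerChar W m e hμ hadd₁
      hadd₂ hgal halt hnd inv S (fun v _ => hinvK v) (fun v _ => hEuler v) (hG S hS) x).mp hx)
    ha hma ha₁ horth

end Places

end Literature.NumberTheory.EllipticCurves

end
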